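import Summits.CriticalPhenomena.CardyFormulaZ2.Theses.CardyMagicRigidity
import Literature.Probability.Percolation.CardyFormulaConformalInvariance
import Literature.Probability.Percolation.BoxCrossingUpperBound
import Literature.Probability.Percolation.ZdNearCriticalWindow
import Literature.Probability.Percolation.HalfSpacePinnedPairs
import Literature.Probability.Percolation.SharpnessDCTProofs
import Literature.Probability.RandomPlanarGeometry.ConformalRectangleProofs
import Literature.Probability.Percolation.TriCrossingSandwich
import Literature.Probability.LatticeModels.MeshDomainBigComponents

/-!
# Line `oracle-sandwich`, stub A: an open `ℤ²`-path poking out across `arc 0`, `arc 2` is a G02 crossing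

Crux `Summit.CriticalPhenomena.CardyFormulaZ2.Theses.CardyMagicRigidity.LoopsToCrossings`
(stmt-CriticalPhenomena-4837), line `oracle-sandwich`, stub `stub_discreteCrossing_of_pathIn`.

This is the bond-percolation (`δℤ²`) port of the lower half of the construction-free
Bollobás–Riordan sandwich (Ch. 7, Claim 19 p. 192 and remark p. 195), whose site-percolation
(`δ𝕋`) twin is `Literature.Probability.Percolation.mem_triCrossing_of_pathIn`
(`TriCrossingSandwich.lean`). For a conformal rectangle `R = (Ω; arcs 0–3)` and small `δ`, `t`:
an open nearest-neighbour path of `ℤ²` inside a site set `S` whose off-`Ω` sites are `t`-close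
to `arc 0 ∪ arc 2` and whose in-`Ω` sites are farther than `δ` from `arc 1 ∪ arc 3`, from an
off-`Ω` site near `arc 0` to an off-`Ω` site near `arc 2`, contains an open path of the discrete
domain `Ω_δ = meshDomain Ω δ` (the LARGEST mesh component, G02) from the discrete arc of `arc 0`
to that of `arc 2`, i.e. `ω ∈ discreteCrossing Ω δ (arc 0) (arc 2)`.

Steps (verbatim port of the `𝕋` proof):
* classification of the steps of the path (`segment_subset_or_nearOut_z2`): inside steps (closed
  mesh edge in `Ω`), outside steps near `arc 0`, outside steps near `arc 2`; run extraction
  (`PathIn.exists_run`, lattice-agnostic, from `TriCrossingSandwich.lean`);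
* the two ends of the inside run are heads of outside steps, hence within `δ` of the respective
  arcs (`exists_mem_dist_le_of_nearOut_z2`), so they are boundary vertices on the right discrete
  arcs (`mem_discreteArc_of_dist_le_z2`, tie rule `≤`);
* the run is long (its ends are `≥ dist(arc 0, arc 2) / 2` apart), hence lies in the LARGEST
  mesh component: **big mesh components are the bulk on `δℤ²`**
  (`JordanDomain.exists_mem_meshDomain_of_reachable`, `LatticeModels/MeshDomainBigComponents.lean`,
  from the bulk theorem `JordanDomain.exists_forall_mem_meshDomain_and_reachable` and the
  stray-extent theorem `JordanDomain.mul_sub_lt_of_stray` applied to `D` and to its quarter turn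
  `i·D`).

References: B. Bollobás, O. Riordan, *Percolation* (2006), Ch. 7, Claim 19 p. 192, remark
p. 195; S. Smirnov, C. R. Acad. Sci. Paris 333 (2001), §2 (discretisation `Ω_δ`, discrete arcs).
-/

noncomputable section

namespace Summit.CriticalPhenomena.CardyFormulaZ2.Cruxes.LoopsToCrossings.OracleSandwich

open Summit.CriticalPhenomena.CardyFormulaZ2.Theses.CardyMagicRigidity
open Literature.Probability.RandomPlanarGeometry hiding cardyFunction
open Literature.Probability.Percolation hiding cardyFunction
open Literature.Probability.LatticeModels
open Filter Topology Set MeasureTheory Metric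

/-! ## Steps of a `ℤ²`-path relative to the domain -/

/-- The closed mesh edge of two adjacent sites of `δℤ²` lies in the closed `δ`-ball about its
first endpoint. [folklore] -/
theorem segment_meshPoint_subset_closedBall_z2 {δ : ℝ} (hδ : 0 < δ) {x y : Site 2}
    (h : (zdGraph 2).Adj x y) :
    segment ℝ (meshPoint δ x) (meshPoint δ y) ⊆ closedBall (meshPoint δ x) δ :=
  (convex_closedBall _ _).segment_subset (mem_closedBall_self hδ.le)
    (by rw [mem_closedBall, dist_comm, dist_meshPoint_of_adj h, abs_of_pos hδ])

/-- An outside step near `A` read backwards is an outside step near `A`. [folklore] -/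
theorem nearOut_symm_z2 {Ω : Set ℂ} {δ : ℝ} {A : Set ℂ} {t : ℝ} {x y : Site 2}
    (h : ∃ z ∈ segment ℝ (meshPoint δ x) (meshPoint δ y), z ∉ Ω ∧ infDist z A ≤ t) :
    ∃ z ∈ segment ℝ (meshPoint δ y) (meshPoint δ x), z ∉ Ω ∧ infDist z A ≤ t := by
  obtain ⟨z, hz, hzΩ, hzA⟩ := h
  exact ⟨z, segment_symm ℝ (meshPoint δ x) (meshPoint δ y) ▸ hz, hzΩ, hzA⟩

/-- **Outside steps near two far-apart sets exclude each other** on `δℤ²`: a mesh edge (of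
length `δ`) cannot carry a point within `t` of `A` and a point within `t` of `B` if
`2t + 2δ < dist(A, B)`. [folklore] -/
theorem not_nearOut_z2 {Ω : Set ℂ} {δ : ℝ} (hδ : 0 < δ) {A B : Set ℂ} {t : ℝ}
    (hA : A.Nonempty) (hB : B.Nonempty) (hAB : ∀ a ∈ A, ∀ b ∈ B, 2 * t + 2 * δ < dist a b)
    {x y : Site 2} (hxy : (zdGraph 2).Adj x y)
    (h : ∃ z ∈ segment ℝ (meshPoint δ x) (meshPoint δ y), z ∉ Ω ∧ infDist z A ≤ t)
    (h' : ∃ z ∈ segment ℝ (meshPoint δ x) (meshPoint δ y), z ∉ Ω ∧ infDist z B ≤ t) : False := by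
  obtain ⟨z, hz, -, hzA⟩ := h
  obtain ⟨z', hz', -, hz'B⟩ := h'
  obtain ⟨a, ha, hza⟩ := (infDist_lt_iff hA).1 (show infDist z A < t + δ / 2 by linarith)
  obtain ⟨b, hb, hz'b⟩ := (infDist_lt_iff hB).1 (show infDist z' B < t + δ / 2 by linarith)
  have hzz' : dist z z' ≤ δ := by
    have := dist_le_dist_of_mem_segment hz hz'
    rwa [dist_meshPoint_of_adj hxy, abs_of_pos hδ] at this
  have := hAB a ha b hb
  linarith [dist_triangle4 a z z' b, dist_comm z a]

/-- **Classification of the steps of a `ℤ²`-path.** Let `Ω` be open with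
`frontier Ω ⊆ A ∪ B ∪ C ∪ E`, and let `x ∼ y` in `ℤ²` at mesh `δ > 0`. If `δx ∉ Ω` forces `δx`
to be within `t` of `A` or of `B`, and `δx ∈ Ω` forces `δx` to be farther than `δ` from `C` and
from `E`, then the closed mesh edge `[δx, δy]` lies in `Ω`, or the step is an outside step near
`A`, or an outside step near `B`. [folklore] -/
theorem segment_subset_or_nearOut_z2 {Ω : Set ℂ} (hΩ : IsOpen Ω) {A B C E : Set ℂ}
    (hfr : frontier Ω ⊆ (A ∪ B) ∪ (C ∪ E)) {δ t : ℝ} (hδ : 0 < δ) (ht : 0 ≤ t) {x y : Site 2}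
    (hxy : (zdGraph 2).Adj x y)
    (hout : meshPoint δ x ∉ Ω → infDist (meshPoint δ x) A ≤ t ∨ infDist (meshPoint δ x) B ≤ t)
    (hin : meshPoint δ x ∈ Ω → δ < infDist (meshPoint δ x) C ∧ δ < infDist (meshPoint δ x) E) :
    segment ℝ (meshPoint δ x) (meshPoint δ y) ⊆ Ω ∨
      (∃ z ∈ segment ℝ (meshPoint δ x) (meshPoint δ y), z ∉ Ω ∧ infDist z A ≤ t) ∨
      (∃ z ∈ segment ℝ (meshPoint δ x) (meshPoint δ y), z ∉ Ω ∧ infDist z B ≤ t) := by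
  by_cases hx : meshPoint δ x ∈ Ω
  · by_cases hseg : segment ℝ (meshPoint δ x) (meshPoint δ y) ⊆ Ω
    · exact Or.inl hseg
    · right
      obtain ⟨f, hf, hff⟩ := exists_mem_segment_frontier hΩ hx hseg
      have hfΩ : f ∉ Ω := fun h => by
        rw [hΩ.frontier_eq] at hff
        exact hff.2 h
      have hfd : dist (meshPoint δ x) f ≤ δ := by
        have := segment_meshPoint_subset_closedBall_z2 hδ hxy hf
        rwa [mem_closedBall, dist_comm] at this
      obtain ⟨hC, hE⟩ := hin hx
      rcases hfr hff with (hfA | hfB) | (hfC | hfE)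
      · exact Or.inl ⟨f, hf, hfΩ, by rw [infDist_zero_of_mem hfA]; exact ht⟩
      · exact Or.inr ⟨f, hf, hfΩ, by rw [infDist_zero_of_mem hfB]; exact ht⟩
      · exact absurd ((infDist_le_dist_of_mem hfC).trans hfd) (not_le.2 hC)
      · exact absurd ((infDist_le_dist_of_mem hfE).trans hfd) (not_le.2 hE)
  · right
    rcases hout hx with h | h
    · exact Or.inl ⟨_, left_mem_segment ℝ _ _, hx, h⟩
    · exact Or.inr ⟨_, left_mem_segment ℝ _ _, hx, h⟩

/-- **An inside site at the head of an outside step near `A` is within `δ` of `A`.** If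
`δa ∈ Ω` is farther than `δ` from `C` and `E`, `frontier Ω ⊆ A ∪ B ∪ C ∪ E`,
`2t + 2δ < dist(A, B)`, and `a' → a` is an outside step near `A`, then `[δa, δa']` carries a
frontier point of `A` at distance `≤ δ` from `δa`. [folklore] -/
theorem exists_mem_dist_le_of_nearOut_z2 {Ω : Set ℂ} (hΩ : IsOpen Ω) {A B C E : Set ℂ}
    (hfr : frontier Ω ⊆ (A ∪ B) ∪ (C ∪ E)) (hA : A.Nonempty)
    {δ t : ℝ} (hδ : 0 < δ) (hAB : ∀ p ∈ A, ∀ q ∈ B, 2 * t + 2 * δ < dist p q)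
    {a' a : Site 2} (ha'a : (zdGraph 2).Adj a' a)
    (h : ∃ z ∈ segment ℝ (meshPoint δ a') (meshPoint δ a), z ∉ Ω ∧ infDist z A ≤ t)
    (haΩ : meshPoint δ a ∈ Ω)
    (hin : δ < infDist (meshPoint δ a) C ∧ δ < infDist (meshPoint δ a) E) :
    ∃ f ∈ A, dist (meshPoint δ a) f ≤ δ := by
  obtain ⟨z, hz, hzΩ, hzA⟩ := h
  rw [segment_symm] at hz
  have hseg : ¬ segment ℝ (meshPoint δ a) (meshPoint δ a') ⊆ Ω := fun hs => hzΩ (hs hz)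
  obtain ⟨f, hf, hff⟩ := exists_mem_segment_frontier hΩ haΩ hseg
  have hfd : dist (meshPoint δ a) f ≤ δ := by
    have := segment_meshPoint_subset_closedBall_z2 hδ ha'a.symm hf
    rwa [mem_closedBall, dist_comm] at this
  have hzf : dist z f ≤ δ := by
    have := dist_le_dist_of_mem_segment hz hf
    rwa [dist_meshPoint_of_adj ha'a.symm, abs_of_pos hδ] at this
  refine ⟨f, ?_, hfd⟩
  rcases hfr hff with (hfA | hfB) | (hfC | hfE)
  · exact hfA
  · exfalso
    obtain ⟨p, hp, hzp⟩ := (infDist_lt_iff hA).1 (show infDist z A < t + δ / 2 by linarith)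
    have := hAB p hp f hfB
    have ht : 0 ≤ t := le_trans infDist_nonneg hzA
    linarith [dist_triangle p z f, dist_comm p z]
  · exact absurd ((infDist_le_dist_of_mem hfC).trans hfd) (not_le.2 hin.1)
  · exact absurd ((infDist_le_dist_of_mem hfE).trans hfd) (not_le.2 hin.2)

/-- **Boundary vertices within `δ` of `X`, one mesh off `arc 1 ∪ arc 3`, lie on the discrete
arc of `X`** (Smirnov's tie rule `≤`): the rest of the frontier is `Y ∪ arc 1 ∪ arc 3`, and `Y`
is farther than `2t + 2δ` from `X`. [folklore] -/
theorem mem_discreteArc_of_dist_le_z2 (R : ConformalRectangle) {δ t : ℝ} {X Y : Set ℂ}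
    (hXY : ∀ p ∈ X, ∀ q ∈ Y, 2 * t + 2 * δ < dist p q) (ht : 0 ≤ t)
    (hfrXY : frontier R.carrier ⊆ (X ∪ Y) ∪ (R.arc 1 ∪ R.arc 3))
    (hne : (frontier R.carrier \ X).Nonempty)
    {p : Site 2} {f : ℂ} (hpb : p ∈ meshBoundary R.carrier δ) (hfX : f ∈ X)
    (hpf : dist (meshPoint δ p) f ≤ δ)
    (hpin : δ < infDist (meshPoint δ p) (R.arc 1) ∧ δ < infDist (meshPoint δ p) (R.arc 3)) :
    p ∈ discreteArc R.carrier δ X := by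
  refine ⟨hpb, ?_⟩
  calc infDist (meshPoint δ p) X ≤ dist (meshPoint δ p) f := infDist_le_dist_of_mem hfX
    _ ≤ δ := hpf
    _ ≤ infDist (meshPoint δ p) (frontier R.carrier \ X) := by
      refine (le_infDist hne).2 fun z hz => ?_
      rcases hfrXY hz.1 with (hzX | hzY) | (hz1 | hz3)
      · exact absurd hzX hz.2
      · have := hXY f hfX z hzY
        linarith [dist_triangle f (meshPoint δ p) z, dist_comm f (meshPoint δ p)]
      · exact (hpin.1.trans_le (infDist_le_dist_of_mem hz1)).le
      · exact (hpin.2.trans_le (infDist_le_dist_of_mem hz3)).le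

/-- A path whose steps are mesh edges ending inside `Ω`, from a site inside `Ω`, is a walk of
the mesh vertex graph. [folklore] -/
theorem reachable_meshVertexGraph_of_pathIn_z2 {Ω : Set ℂ} {δ : ℝ} {H : SimpleGraph (Site 2)}
    (hH : ∀ p q, H.Adj p q → (meshGraph Ω δ).Adj p q ∧ meshPoint δ q ∈ Ω)
    {S : Set (Site 2)} {a b : Site 2} (h : PathIn H S a b) (ha : meshPoint δ a ∈ Ω) :
    ∃ hb : meshPoint δ b ∈ Ω,
      (meshVertexGraph Ω δ).Reachable (⟨a, ha⟩ : meshVertices Ω δ) ⟨b, hb⟩ := by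
  obtain ⟨-, hr⟩ := h
  induction hr with
  | refl => exact ⟨ha, SimpleGraph.Reachable.refl _⟩
  | @tail p q _ hpq ih =>
    obtain ⟨hp, hreach⟩ := ih
    obtain ⟨hadj, hq⟩ := hH p q hpq.1
    exact ⟨hq, hreach.trans (SimpleGraph.Adj.reachable
      (show (meshVertexGraph Ω δ).Adj ⟨p, hp⟩ ⟨q, hq⟩ from hadj))⟩

/-- Restricting the ambient set of a path to an invariant set: if `a ∈ T` and `T` is closed
under the steps of the path between sites of `S`, the path lies inside `T ∩ S`. [folklore] -/
theorem pathIn_inter_of_invariant_z2 {V : Type*} {H : SimpleGraph V} {S T : Set V} {a b : V}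
    (h : PathIn H S a b) (ha : a ∈ T) (hT : ∀ p ∈ S, ∀ q ∈ S, p ∈ T → H.Adj p q → q ∈ T) :
    PathIn H (T ∩ S) a b := by
  obtain ⟨haS, hr⟩ := h
  refine ⟨⟨ha, haS⟩, ?_⟩
  induction hr with
  | refl => exact Relation.ReflTransGen.refl
  | @tail p q hap hpq ih =>
    have hp : p ∈ T ∩ S := PathIn.right_mem (show PathIn H (T ∩ S) a p from ⟨⟨ha, haS⟩, ih⟩)
    exact ih.tail ⟨hpq.1, hT p hp.2 q hpq.2 hp.1 hpq.1, hpq.2⟩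

/-! ## The stub -/

/-- **Stub A — bond port of the lower half of the Bollobás–Riordan sandwich** (deterministic,
EVERY Jordan conformal rectangle; the `𝕋` twin `mem_triCrossing_of_pathIn` is proved in
`TriCrossingSandwich.lean`). For `0 < δ < δ₀(R)`, `0 ≤ t ≤ t₀(R)`: an open `ℤ²`-path inside a
site set `S` whose off-`Ω` sites are `t`-close to `arc 0 ∪ arc 2` and whose in-`Ω` sites keep
one mesh off `arc 1 ∪ arc 3`, from an off-`Ω` site near `arc 0` to an off-`Ω` site near `arc 2`,
contains a G02 crossing of `Ω_δ` (largest mesh component, discrete arcs): between the last step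
near `arc 0` and the first later step near `arc 2` lies a run of open inside steps
(`PathIn.exists_run`), whose ends are boundary vertices on the discrete arcs of `arc 0`, `arc 2`
(`exists_mem_dist_le_of_nearOut_z2`, `mem_discreteArc_of_dist_le_z2`) and which is long, hence
in the bulk (`JordanDomain.exists_mem_meshDomain_of_reachable`).
[cite: BollobasRiordan2006, Ch. 7 Claim 19 p. 192 and remark p. 195] -/
theorem stub_discreteCrossing_of_pathIn :
    ∀ R : ConformalRectangle,
      ∃ δ₀ > 0, ∃ t₀ > 0, ∀ δ t : ℝ, 0 < δ → δ < δ₀ → 0 ≤ t → t ≤ t₀ →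
        ∀ (ω : BondConfig (Site 2)) (S : Set (Site 2)) (u v : Site 2),
          (∀ x ∈ S, meshPoint δ x ∉ R.carrier →
            infDist (meshPoint δ x) (R.arc 0) ≤ t ∨ infDist (meshPoint δ x) (R.arc 2) ≤ t) →
          (∀ x ∈ S, meshPoint δ x ∈ R.carrier →
            δ < infDist (meshPoint δ x) (R.arc 1) ∧ δ < infDist (meshPoint δ x) (R.arc 3)) →
          meshPoint δ u ∉ R.carrier → infDist (meshPoint δ u) (R.arc 0) ≤ t →
          meshPoint δ v ∉ R.carrier → infDist (meshPoint δ v) (R.arc 2) ≤ t →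
          PathIn (openGraph ω ⊓ zdGraph 2) S u v →
          ω ∈ discreteCrossing R.carrier δ (R.arc 0) (R.arc 2) := by
  intro R
  obtain ⟨ε, hε, hεd⟩ := R.exists_pos_forall_lt_dist_arc
  obtain ⟨δ₁, hδ₁, hBC⟩ :=
    R.toJordanDomain.exists_mem_meshDomain_of_reachable (d₀ := ε / 2) (by positivity)
  refine ⟨min δ₁ (ε / 8), by positivity, ε / 8, by positivity, ?_⟩
  intro δ t hδ hδlt ht htle ω S u v hout hin huΩ huA hvΩ hvB hP
  have hδδ₁ : δ < δ₁ := hδlt.trans_le (min_le_left _ _)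
  have hδε : δ < ε / 8 := hδlt.trans_le (min_le_right _ _)
  set Ω := R.carrier with hΩ
  set A := R.arc 0 with hA
  set B := R.arc 2 with hB
  have hΩo : IsOpen Ω := R.isOpen
  have hfr : frontier Ω ⊆ (A ∪ B) ∪ (R.arc 1 ∪ R.arc 3) := frontier_subset_arcs_zero_two R
  have hfr' : frontier Ω ⊆ (B ∪ A) ∪ (R.arc 1 ∪ R.arc 3) := hfr.trans (by rw [union_comm A B])
  have hAne : A.Nonempty := ⟨_, R.pt_mem_arc_self 0⟩
  have hBne : B.Nonempty := ⟨_, R.pt_mem_arc_self 2⟩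
  have hAB : ∀ p ∈ A, ∀ q ∈ B, 2 * t + 2 * δ < dist p q := fun p hp q hq => by
    linarith [hεd p hp q hq]
  have hBA : ∀ p ∈ B, ∀ q ∈ A, 2 * t + 2 * δ < dist p q := fun p hp q hq => by
    rw [dist_comm]; exact hAB q hq p hp
  -- the inside graph: open mesh edges with both end-points in `Ω`
  obtain ⟨H, hH⟩ : ∃ H : SimpleGraph (Site 2), H = (openGraph ω ⊓ zdGraph 2) ⊓
      SimpleGraph.fromRel (fun x y : Site 2 =>
        (meshGraph Ω δ).Adj x y ∧ meshPoint δ x ∈ Ω ∧ meshPoint δ y ∈ Ω) := ⟨_, rfl⟩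
  have hHadj : ∀ x y, H.Adj x y ↔ (openGraph ω ⊓ zdGraph 2).Adj x y ∧
      (meshGraph Ω δ).Adj x y ∧ meshPoint δ x ∈ Ω ∧ meshPoint δ y ∈ Ω := by
    intro x y
    rw [hH, SimpleGraph.inf_adj, SimpleGraph.fromRel_adj]
    constructor
    · rintro ⟨hG, -, h | h⟩
      · exact ⟨hG, h⟩
      · exact ⟨hG, h.1.symm, h.2.2, h.2.1⟩
    · rintro ⟨hG, h⟩
      exact ⟨hG, hG.ne, Or.inl h⟩
  have hHG : H ≤ openGraph ω ⊓ zdGraph 2 := fun x y h => ((hHadj x y).1 h).1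
  -- the three kinds of steps
  have hclass : ∀ a ∈ S, ∀ b ∈ S, (openGraph ω ⊓ zdGraph 2).Adj a b →
      H.Adj a b ∨
        (∃ z ∈ segment ℝ (meshPoint δ a) (meshPoint δ b), z ∉ Ω ∧ infDist z A ≤ t) ∨
        (∃ z ∈ segment ℝ (meshPoint δ a) (meshPoint δ b), z ∉ Ω ∧ infDist z B ≤ t) := by
    intro a haS b _ hab
    have hab' : (zdGraph 2).Adj a b := ((SimpleGraph.inf_adj _ _ _ _).1 hab).2
    rcases segment_subset_or_nearOut_z2 hΩo hfr hδ ht hab' (hout a haS) (hin a haS)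
      with h | h | h
    · refine Or.inl ((hHadj a b).2 ⟨hab, ?_, h (left_mem_segment ℝ _ _),
        h (right_mem_segment ℝ _ _)⟩)
      exact meshGraph_adj_iff.2 ⟨hab', h.trans subset_closure⟩
    · exact Or.inr (Or.inl h)
    · exact Or.inr (Or.inr h)
  have hu' : ∀ b ∈ S, (openGraph ω ⊓ zdGraph 2).Adj u b → ¬ H.Adj u b ∧
      (∃ z ∈ segment ℝ (meshPoint δ u) (meshPoint δ b), z ∉ Ω ∧ infDist z A ≤ t) :=
    fun b _ _ => ⟨fun h => huΩ ((hHadj u b).1 h).2.2.1, _, left_mem_segment ℝ _ _, huΩ, huA⟩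
  have hv' : ∀ a ∈ S, (openGraph ω ⊓ zdGraph 2).Adj a v → ¬ H.Adj a v ∧
      ¬ (∃ z ∈ segment ℝ (meshPoint δ a) (meshPoint δ v), z ∉ Ω ∧ infDist z A ≤ t) :=
    fun a _ hav => ⟨fun h => hvΩ ((hHadj a v).1 h).2.2.2,
      fun h => not_nearOut_z2 hδ hAne hBne hAB ((SimpleGraph.inf_adj _ _ _ _).1 hav).2 h
        (nearOut_symm_z2 ⟨_, left_mem_segment ℝ _ _, hvΩ, hvB⟩)⟩
  have huv : u ≠ v := by
    rintro rfl
    obtain ⟨p, hp, hup⟩ := (infDist_lt_iff hAne).1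
      (show infDist (meshPoint δ u) A < t + δ by linarith)
    obtain ⟨q, hq, huq⟩ := (infDist_lt_iff hBne).1
      (show infDist (meshPoint δ u) B < t + δ by linarith)
    linarith [hAB p hp q hq, dist_triangle p (meshPoint δ u) q, dist_comm p (meshPoint δ u)]
  obtain ⟨a', a, b, b', -, ha'a, hnH, hL0, hrun, -, hbb', hnHb, hnL0, hL2⟩ :=
    PathIn.exists_run (H := H) hHG hclass hu' hv' huv hP
  have haS : a ∈ S := hrun.left_mem
  have hbS : b ∈ S := hrun.right_mem
  have ha'azd : (zdGraph 2).Adj a' a := ((SimpleGraph.inf_adj _ _ _ _).1 ha'a).2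
  have hbb'zd : (zdGraph 2).Adj b b' := ((SimpleGraph.inf_adj _ _ _ _).1 hbb').2
  -- the ends of the run are inside `Ω`
  have haΩ : meshPoint δ a ∈ Ω := by
    by_contra h
    rcases hout a haS h with h' | h'
    · by_cases hab : a = b
      · subst hab
        exact hnL0 ⟨_, left_mem_segment ℝ _ _, h, h'⟩
      · obtain ⟨c, -, hac⟩ := hrun.exists_adj_head hab
        exact h ((hHadj a c).1 hac).2.2.1
    · exact not_nearOut_z2 hδ hAne hBne hAB ha'azd hL0
        (nearOut_symm_z2 ⟨_, left_mem_segment ℝ _ _, h, h'⟩)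
  have hbΩ : meshPoint δ b ∈ Ω := by
    by_contra h
    rcases hout b hbS h with h' | h'
    · exact hnL0 ⟨_, left_mem_segment ℝ _ _, h, h'⟩
    · by_cases hab : a = b
      · subst hab
        exact not_nearOut_z2 hδ hAne hBne hAB ha'azd hL0
          (nearOut_symm_z2 ⟨_, left_mem_segment ℝ _ _, h, h'⟩)
      · obtain ⟨c, -, hcb⟩ := hrun.exists_adj_last hab
        exact h ((hHadj c b).1 hcb).2.2.2
  -- the exits at the two ends
  obtain ⟨fa, hfaA, hafa⟩ :=
    exists_mem_dist_le_of_nearOut_z2 hΩo hfr hAne hδ hAB ha'azd hL0 haΩ (hin a haS haΩ)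
  obtain ⟨fb, hfbB, hbfb⟩ :=
    exists_mem_dist_le_of_nearOut_z2 hΩo hfr' hBne hδ hBA hbb'zd.symm (nearOut_symm_z2 hL2) hbΩ
      (hin b hbS hbΩ)
  -- the run is long, hence in the bulk
  have hfar : ε / 2 ≤ dist (meshPoint δ a) (meshPoint δ b) := by
    have := hεd fa hfaA fb hfbB
    linarith [dist_triangle4 fa (meshPoint δ a) (meshPoint δ b) fb, dist_comm fa (meshPoint δ a)]
  have hHmesh : ∀ p q, H.Adj p q → (meshGraph Ω δ).Adj p q ∧ meshPoint δ q ∈ Ω := fun p q h =>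
    ⟨((hHadj p q).1 h).2.1, ((hHadj p q).1 h).2.2.2⟩
  obtain ⟨hbΩ', hreach⟩ := reachable_meshVertexGraph_of_pathIn_z2 hHmesh hrun haΩ
  have haD : a ∈ meshDomain Ω δ := hBC δ hδ hδδ₁ ⟨a, haΩ⟩ ⟨b, hbΩ'⟩ hreach hfar
  have hrun' : PathIn H (meshDomain Ω δ ∩ S) a b :=
    pathIn_inter_of_invariant_z2 hrun haD fun p _ q _ hpD hpq =>
      mem_meshDomain_of_meshGraph_adj hpD ((hHadj p q).1 hpq).2.2.2 ((hHadj p q).1 hpq).2.1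
  have hbD : b ∈ meshDomain Ω δ := hrun'.right_mem.1
  have hpath : PathIn (openGraph ω ⊓ discreteDomainGraph Ω δ) (meshDomain Ω δ ∩ S) a b :=
    hrun'.mono_of_adj (fun p hp q hq hpq => (SimpleGraph.inf_adj _ _ _ _).2
      ⟨((SimpleGraph.inf_adj _ _ _ _).1 ((hHadj p q).1 hpq).1).1,
        discreteDomainGraph_adj_iff.2 ⟨((hHadj p q).1 hpq).2.1, hp.1, hq.1⟩⟩) (fun _ hp => hp)
  -- the ends are boundary vertices on the right discrete arcs
  have hbdry : ∀ {p p' : Site 2}, p ∈ meshDomain Ω δ → meshPoint δ p ∈ Ω →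
      (openGraph ω ⊓ zdGraph 2).Adj p' p → ¬ H.Adj p' p → p ∈ meshBoundary Ω δ := by
    intro p p' hpD hpΩ hp'p hnH
    refine ⟨hpD, p', ((SimpleGraph.inf_adj _ _ _ _).1 hp'p).2.symm, fun hadj => hnH ?_⟩
    obtain ⟨hmesh, -, hp'D⟩ := discreteDomainGraph_adj_iff.1 hadj
    exact (hHadj p' p).2 ⟨hp'p, hmesh.symm, meshDomain_subset_meshVertices Ω δ hp'D, hpΩ⟩
  have hdisj := R.disjoint_arc_zero_arc_two
  have hneA : (frontier Ω \ A).Nonempty :=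
    ⟨R.pt 2, R.arc_subset_frontier 2 (R.pt_mem_arc_self 2),
      fun h => Set.disjoint_left.1 hdisj h (R.pt_mem_arc_self 2)⟩
  have hneB : (frontier Ω \ B).Nonempty :=
    ⟨R.pt 0, R.arc_subset_frontier 0 (R.pt_mem_arc_self 0),
      fun h => Set.disjoint_left.1 hdisj (R.pt_mem_arc_self 0) h⟩
  have haB : a ∈ meshBoundary Ω δ := hbdry haD haΩ ha'a hnH
  have hbB' : b ∈ meshBoundary Ω δ := hbdry hbD hbΩ hbb'.symm (fun h => hnHb h.symm)
  have haArc : a ∈ discreteArc Ω δ A :=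
    mem_discreteArc_of_dist_le_z2 R hAB ht hfr hneA haB hfaA hafa (hin a haS haΩ)
  have hbArc : b ∈ discreteArc Ω δ B :=
    mem_discreteArc_of_dist_le_z2 R hBA ht hfr' hneB hbB' hfbB hbfb (hin b hbS hbΩ)
  exact mem_discreteCrossing_iff.2 ⟨a, haArc, b, hbArc, DCT16.reachable_of_pathIn hpath⟩

end Summit.CriticalPhenomena.CardyFormulaZ2.Cruxes.LoopsToCrossings.OracleSandwich
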